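import Summits.CriticalPhenomena.SAWScalingLimit.Theorems.SAWDefectDecoherenceBoundaryClosureRHexagonOscillation
import Mathlib.Algebra.BigOperators.Finprod

/-!
# Pick engine, STAGE 1 (S3) helper: summation by parts for the developing map

Support file for crux `BoundaryClosureR` (stmt-CriticalPhenomena-14004), line `pick-half-plane`,
stub `stub_pickEngine`, step (S3).  A developing map `H` of `F dz` on the sites of `𝕋` has the
increments `H(spoke s k) − H(s) = m_k · F(edge s k)` at every interior site (`potential_spoke`,
`Hexagon.hexMidpoint_edge_sub`; `m_k = mvec k`, `|m_k|² = 1/12`).  The spoke is a TRANSLATION,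
`spoke s k = s + d_k` with `d_k := spoke 0 k` (`spoke_eq_add`), so a weighted site sum of
increments is, by Abel summation on `ℤ²` (`sum_mul_shift`),

  `Σ_s c(s) · m_k F(edge s k) = Σ_s c(s) (H(s + d_k) − H(s)) = −Σ_s (c(s) − c(s − d_k)) · H(s)`

(`pickEngine_potentialByParts`, registered).  The file also records the hexagon frame algebra used
downstream to turn the six directional differences into Wirtinger derivatives: the embedded spoke
vectors `D_k = triEmbed d_k = (ζ, ζ−1, −1, −ζ, 1−ζ, 1)` (unit vectors, `mid(edge s k) = s + D_k/2`),
the inverse `m_k⁻¹ = 12 · conj m_k`, and the two FRAME SUMS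

  `Σ_k 12 conj(m_k) (P D_k + Q conj D_k) = 12(2ζ − 1) · P`          (`2ζ − 1 = i√3`)
  `Σ_k conj(u_k) · 12 conj(m_k) (P D_k + Q conj D_k) = −12 · Q`     (`u = (b, a, c, b, a, c)`)

(`frame_sum_inv`, `frame_sum_conj_inv`): against the plain cover the `∂̄`-parts cancel, against
the conjugate-class weights the `∂`-parts cancel.  References: folklore (Abel summation);
Duminil-Copin–Smirnov (2012), §3.
-/

noncomputable section

open scoped BigOperators ComplexConjugate
open Finset
open Literature.Probability.LatticeModels Literature.Probability.RandomPlanarGeometry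
open Literature.Probability.RandomPlanarGeometry.SAW
open Literature.Barriers.CriticalPhenomena Literature.Barriers.CriticalPhenomena.HexKernel
open Summit.CriticalPhenomena.SAWScalingLimit.Theorems.PickHalfPlane
open Summit.CriticalPhenomena.SAWScalingLimit.Theorems.PickHalfPlane.Hexagon

namespace Summit.CriticalPhenomena.SAWScalingLimit.Theorems.PickHalfPlane.Engine

/-! ### The spokes are translations -/

/-- `spoke s k = s + d_k` with the constant lattice vector `d_k = spoke 0 k`. [folklore] -/
theorem spoke_eq_add (s : Site 2) (k : Fin 6) : spoke s k = s + spoke 0 k := by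
  fin_cases k <;> simp [spoke, sub_eq_add_neg]

/-- The embedded spoke vectors `D_k = triEmbed (spoke 0 k)`: `ζ, ζ − 1, −1, −ζ, 1 − ζ, 1`. [folklore] -/
theorem triEmbed_spoke_zero (k : Fin 6) :
    triEmbed (spoke 0 k) = ![triZeta, triZeta - 1, -1, -triZeta, 1 - triZeta, 1] k := by
  fin_cases k <;> simp [spoke, triEmbed_neg, sub_eq_add_neg]

/-- `triEmbed (spoke s k) = triEmbed s + D_k`. [folklore] -/
theorem triEmbed_spoke (s : Site 2) (k : Fin 6) :
    triEmbed (spoke s k) = triEmbed s + triEmbed (spoke 0 k) := by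
  rw [spoke_eq_add, triEmbed_add]

/-- The spoke vectors are unit vectors. [folklore] -/
theorem norm_triEmbed_spoke_zero (k : Fin 6) : ‖triEmbed (spoke 0 k)‖ = 1 := by
  have h3 : Real.sqrt 3 * Real.sqrt 3 = 3 := Real.mul_self_sqrt (by norm_num)
  have hsq : ‖triEmbed (spoke 0 k)‖ ^ 2 = 1 := by
    rw [← Complex.normSq_eq_norm_sq, triEmbed_spoke_zero]
    fin_cases k <;> simp [Complex.normSq_apply] <;> nlinarith [h3]
  have h0 : 0 ≤ ‖triEmbed (spoke 0 k)‖ := norm_nonneg _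
  nlinarith [hsq, h0]

/-- **The mid-edge sits halfway along the spoke**: `mid(edge s k) = triEmbed s + D_k / 2`.
[folklore] -/
theorem hexMidpoint_edge_eq (s : Site 2) (k : Fin 6) :
    hexMidpoint (edge s k) = triEmbed s + triEmbed (spoke 0 k) / 2 := by
  rw [triEmbed_spoke_zero]
  fin_cases k <;>
    (simp [edge, face, hexCenter_mk, HexKernel.triEmbed_sub]; ring)

/-! ### The inverse half-edge vectors and the two frame sums -/

/-- `m_k · (12 conj m_k) = 1` (`|m_k|² = 1/12`). [folklore] -/
theorem mvec_mul_twelve_conj (k : Fin 6) : mvec k * (12 * conj (mvec k)) = 1 := by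
  have h : mvec k * conj (mvec k) = ((1 / 12 : ℝ) : ℂ) := by
    rw [Complex.mul_conj, normSq_mvec]
  calc mvec k * (12 * conj (mvec k)) = 12 * (mvec k * conj (mvec k)) := by ring
    _ = 1 := by rw [h]; push_cast; ring

/-- `‖12 conj m_k‖ ≤ 4` (it equals `2√3`). [folklore] -/
theorem norm_twelve_conj_mvec_le (k : Fin 6) : ‖(12 : ℂ) * conj (mvec k)‖ ≤ 4 := by
  have hsq : ‖mvec k‖ ^ 2 = 1 / 12 := by rw [← Complex.normSq_eq_norm_sq, normSq_mvec]
  have h0 : 0 ≤ ‖mvec k‖ := norm_nonneg _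
  have hle : ‖mvec k‖ ≤ 1 / 3 := by nlinarith
  rw [norm_mul, Complex.norm_conj]
  calc ‖(12 : ℂ)‖ * ‖mvec k‖ ≤ 12 * (1 / 3) := by
        gcongr; simp
    _ = 4 := by norm_num

/-- The orientation vectors `u = (b, a, c, b, a, c)` have norm `≤ 1` (indeed `1/√3`). [folklore] -/
theorem norm_orient_le (k : Fin 6) : ‖(![vecB, vecA, vecC, vecB, vecA, vecC] : Fin 6 → ℂ) k‖ ≤ 1 := by
  have h3 : Real.sqrt 3 * Real.sqrt 3 = 3 := Real.mul_self_sqrt (by norm_num)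
  have hsq : ‖(![vecB, vecA, vecC, vecB, vecA, vecC] : Fin 6 → ℂ) k‖ ^ 2 = 1 / 3 := by
    rw [← Complex.normSq_eq_norm_sq]
    fin_cases k <;> simp [vecA, vecB, vecC, Complex.normSq_apply] <;> nlinarith [h3]
  have h0 : 0 ≤ ‖(![vecB, vecA, vecC, vecB, vecA, vecC] : Fin 6 → ℂ) k‖ := norm_nonneg _
  nlinarith [hsq, h0]

/-- **First frame sum** (plain cover): `Σ_k 12 conj(m_k) · (P D_k + Q conj D_k) = 12(2ζ − 1) P` —
the `Q`-part cancels (`Σ_k conj(m_k) conj(D_k) = 0`), `2ζ − 1 = i√3`. [folklore] -/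
theorem frame_sum_inv (P Q : ℂ) :
    ∑ k : Fin 6, 12 * conj (mvec k) *
        (P * triEmbed (spoke 0 k) + Q * conj (triEmbed (spoke 0 k))) =
      12 * (2 * triZeta - 1) * P := by
  have hc : conj triZeta = 1 - triZeta := Complex.ext (by simp; norm_num) (by simp)
  simp only [Fin.sum_univ_six, triEmbed_spoke_zero]
  simp [mvec, fvec, vecA, vecB, vecC, map_ofNat, hc]
  ring

/-- **Second frame sum** (conjugate-class weights `u = (b, a, c, b, a, c)`):
`Σ_k conj(u_k) · 12 conj(m_k) · (P D_k + Q conj D_k) = −12 Q` — the `P`-part cancels. [folklore] -/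
theorem frame_sum_conj_inv (P Q : ℂ) :
    ∑ k : Fin 6, conj ((![vecB, vecA, vecC, vecB, vecA, vecC] : Fin 6 → ℂ) k) *
        (12 * conj (mvec k)) * (P * triEmbed (spoke 0 k) + Q * conj (triEmbed (spoke 0 k))) =
      -12 * Q := by
  have h := triZeta_sq
  have hc : conj triZeta = 1 - triZeta := Complex.ext (by simp; norm_num) (by simp)
  simp only [Fin.sum_univ_six, triEmbed_spoke_zero]
  simp [mvec, fvec, vecA, vecB, vecC, map_ofNat, hc]
  linear_combination (-4 * P + 12 * Q) * h

/-! ### Abel summation on `ℤ²` and the by-parts identity -/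

/-- **Abel shift.** If `c` vanishes outside `T` and `T` contains `s + d` whenever `c s ≠ 0`, then
`Σ_{s ∈ T} c(s) H(s + d) = Σ_{s ∈ T} c(s − d) H(s)`. [folklore] -/
theorem sum_mul_shift (T : Finset (Site 2)) (c H : Site 2 → ℂ) (d : Site 2)
    (hc : ∀ s : Site 2, c s ≠ 0 → s ∈ T ∧ s + d ∈ T) :
    ∑ s ∈ T, c s * H (s + d) = ∑ s ∈ T, c (s - d) * H s := by
  have h1 : ∑ᶠ s, c s * H (s + d) = ∑ s ∈ T, c s * H (s + d) := by
    refine finsum_eq_sum_of_support_subset _ fun s hs => ?_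
    exact (hc s fun h0 => hs (by simp [h0])).1
  have h2 : ∑ᶠ s, c (s - d) * H s = ∑ s ∈ T, c (s - d) * H s := by
    refine finsum_eq_sum_of_support_subset _ fun s hs => ?_
    have hc0 : c (s - d) ≠ 0 := fun h0 => hs (by simp [h0])
    have := (hc (s - d) hc0).2
    rwa [sub_add_cancel] at this
  rw [← h1, ← h2, ← finsum_comp_equiv (Equiv.addRight d) (f := fun s => c (s - d) * H s)]
  simp

/-- **Abel summation.** Under the same support hypothesis,
`Σ_{s ∈ T} c(s) (H(s + d) − H(s)) = −Σ_{s ∈ T} (c(s) − c(s − d)) H(s)`. [folklore] -/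
theorem sum_mul_sub_eq_neg_sum (T : Finset (Site 2)) (c H : Site 2 → ℂ) (d : Site 2)
    (hc : ∀ s : Site 2, c s ≠ 0 → s ∈ T ∧ s + d ∈ T) :
    ∑ s ∈ T, c s * (H (s + d) - H s) = -∑ s ∈ T, (c s - c (s - d)) * H s := by
  simp only [mul_sub, sub_mul, Finset.sum_sub_distrib, sum_mul_shift T c H d hc]
  ring

/-- The increments of a developing map of the critical observable around an interior site, in
the form used below: `H(spoke s k) − H(s) = m_k · F(edge s k)`. [folklore] -/
theorem potential_increment {Λ : Finset HexVertex} {a : Sym2 HexVertex} {H : Site 2 → ℂ}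
    (hH : IsPotential Λ a H) {s : Site 2} (hs : IsInteriorSite Λ s) (k : Fin 6) :
    H (spoke s k) - H s =
      mvec k * hexParafermionicObservable Λ a hexCriticalFugacity (5 / 8) (HexKernel.edge s k) := by
  rw [potential_spoke hH hs k, edgeValue, hexMidpoint_edge_sub]

/-- **Summation by parts for the developing map (registered sub-goal
`pickEngine_potentialByParts` of stub `stub_pickEngine`).** Let `H`, `F` satisfy the increment
relation `H(spoke s k) − H(s) = m_k F(edge s k)` at every interior site of `S` (e.g. a developing
map of the critical observable, `potential_increment`), and let the weight `c` be supported on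
interior sites `s` with `s, spoke s k ∈ T`.  Then
`Σ_{s ∈ T} c(s) · m_k F(edge s k) = −Σ_{s ∈ T} (c(s) − c(s − d_k)) · H(s)`, `d_k = spoke 0 k`.
[folklore] -/
theorem pickEngine_potentialByParts :
    ∀ (S : Finset HexVertex) (T : Finset (Site 2)) (F : Sym2 HexVertex → ℂ) (H c : Site 2 → ℂ)
      (k : Fin 6),
      (∀ s : Site 2, IsInteriorSite S s → H (spoke s k) - H s = mvec k * F (HexKernel.edge s k)) →
      (∀ s : Site 2, c s ≠ 0 → IsInteriorSite S s ∧ s ∈ T ∧ spoke s k ∈ T) →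
      ∑ s ∈ T, c s * (mvec k * F (HexKernel.edge s k)) =
        -∑ s ∈ T, (c s - c (s - spoke 0 k)) * H s := by
  intro S T F H c k hHF hc
  have hc' : ∀ s : Site 2, c s ≠ 0 → s ∈ T ∧ s + spoke 0 k ∈ T := fun s h =>
    ⟨(hc s h).2.1, by rw [← spoke_eq_add]; exact (hc s h).2.2⟩
  rw [← sum_mul_sub_eq_neg_sum T c H (spoke 0 k) hc']
  refine Finset.sum_congr rfl fun s _ => ?_
  by_cases h0 : c s = 0
  · rw [h0, zero_mul, zero_mul]
  · rw [← hHF s (hc s h0).1, spoke_eq_add]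

end Summit.CriticalPhenomena.SAWScalingLimit.Theorems.PickHalfPlane.Engine

end
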